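import Literature.Analysis.FluidPDE.MVIntegrandsMeasurability
import HarnessLib

/-!
# Definitions for the assembly of the weak–strong uniqueness argument (Březina–Feireisl 2018, §3)

The (few) definitions needed by the measure-theoretic assembly of BF's proof of Theorem 3.3 in
the kernel framework of `DissipativeMVEuler.lean`, collected in one file so that the remaining
files of the argument are theorem-only:

* `momentFun'` — a measurable modification of the moment function off the open quadrant;
* `TestTriple` — global `C¹` extensions `ψ₁, ψ₂, ψ₃` of BF's test functions `½|u|² - μ(ρ,ϑ)`,
  `u`, `ϑ` beyond `[0,T']` (from `Torus.exists_contDiff_one_extension`), with the rewriting lemmas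
  for their derivatives on `(0,T')`;
* `CoeffBound` — uniform bounds of the coefficients of the strong solution on `[0,T] × 𝕋³`;
* `lowerCutoff` — the non-positive entropy cut-off `Z₋` of the minimum principle (BF Lemma 2.5),
  and the constant test function `1`;
* `divPU`, `avgRelEnergy`, `avgRelEnergyZ` — the pressure-flux divergence of the point data and
  the `Y`-averaged relative energies without / with cut-off.

## References

* J. Březina, E. Feireisl, J. Math. Soc. Japan 70 (2018), §2.2, Lemma 2.5, (3.3)–(3.5).
-/

noncomputable section

open Set Function MeasureTheory ProbabilityTheory Filter
open scoped BigOperators ENNReal Topology InnerProductSpace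

namespace Literature.Analysis.FluidPDE

namespace CompressibleEuler

open Literature.Analysis.FunctionSpaces EulerPhase StrongPointData EulerEOS
open Literature.Analysis.FunctionSpaces.Torus hiding kineticEnergy

variable {eos : EulerEOS}

/-! ## The measurable moment function -/

open Classical in
/-- A measurable modification of the moment function off the quadrant. [folklore] -/
def momentFun' (eos : EulerEOS) : EulerPhase → ℝ :=
  phaseQuadrant.piecewise (momentFun eos.toConservative) 0

open Classical in
/-- The modification is measurable. [folklore] -/
theorem measurable_momentFun' (hG : eos.IsGibbs) (hS : eos.IsThermodynamicallyStable)
    (htemp : ∀ r E : ℝ, 0 < r → 0 < E →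
      0 < eos.temperature r E ∧ r * eos.e r (eos.temperature r E) = E) :
    Measurable (momentFun' eos) := by
  unfold momentFun'
  exact measurable_piecewise_zero (continuousOn_momentFun hG hS htemp) measurableSet_phaseQuadrant

open Classical in
/-- The modification agrees with the moment function on the quadrant. [folklore] -/
theorem momentFun'_eq {w : EulerPhase} (hw : w ∈ phaseQuadrant) :
    momentFun' eos w = momentFun eos.toConservative w := by
  unfold momentFun'; simp [Set.piecewise, hw]

/-- The lower integral of the moment function against a fibre equals that of its measurable
modification (the fibre is carried by the quadrant). [folklore] -/
theorem lintegral_momentFun'_eq {μ : Measure EulerPhase} (hμ : ∀ᵐ w ∂μ, w ∈ phaseQuadrant) :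
    ∫⁻ w, ENNReal.ofReal (momentFun' eos w) ∂μ = ∫⁻ w, ENNReal.ofReal (momentFun eos.toConservative w) ∂μ :=
  lintegral_congr_ae (hμ.mono fun w hw => by beta_reduce; rw [momentFun'_eq hw])


/-! ## The test functions -/

/-- Global `C¹` extensions beyond `[0,T']`, `T < T' < T₁`, of BF's test functions
`φ₁ = ½|u|² - μ(ρ,ϑ)`, `u`, `ϑ` built from the strong solution, with matching values on `[0,T']`
and matching time derivatives on `(0,T')`. [cite: BrezinaFeireisl2018, (3.4)] -/
structure TestTriple (eos : EulerEOS) (T T₁ : ℝ) (ρ : ℝ → UnitAddTorus (Fin 3) → ℝ)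
    (u : ℝ → UnitAddTorus (Fin 3) → EuclideanSpace ℝ (Fin 3)) (ϑ : ℝ → UnitAddTorus (Fin 3) → ℝ) where
  /-- the intermediate time -/
  T' : ℝ
  /-- `T < T'` -/
  hT : T < T'
  /-- `T' < T₁` -/
  hT' : T' < T₁
  /-- extension of `φ₁` -/
  ψ₁ : ℝ → UnitAddTorus (Fin 3) → ℝ
  /-- extension of `u` -/
  ψ₂ : ℝ → UnitAddTorus (Fin 3) → EuclideanSpace ℝ (Fin 3)
  /-- extension of `ϑ` -/
  ψ₃ : ℝ → UnitAddTorus (Fin 3) → ℝ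
  /-- `ψ₁` is a `C¹` test function -/
  hψ₁ : IsTestFunction ψ₁
  /-- `ψ₂` is a `C¹` vector test function -/
  hψ₂ : IsVectorTestFunction ψ₂
  /-- `ψ₃` is a `C¹` test function -/
  hψ₃ : IsTestFunction ψ₃
  /-- `ψ₁ = φ₁` on `[0,T']` -/
  eq₁ : ∀ t ∈ Icc 0 T', ∀ x, ψ₁ t x = energyTestFunction eos ρ u ϑ t x
  /-- `ψ₂ = u` on `[0,T']` -/
  eq₂ : ∀ t ∈ Icc 0 T', ∀ x, ψ₂ t x = u t x
  /-- `ψ₃ = ϑ` on `[0,T']` -/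
  eq₃ : ∀ t ∈ Icc 0 T', ∀ x, ψ₃ t x = ϑ t x
  /-- `∂ₜψ₁ = ∂ₜφ₁` on `(0,T')` -/
  dt₁ : ∀ t ∈ Ioo 0 T', ∀ x, timeDeriv ψ₁ t x = timeDeriv (energyTestFunction eos ρ u ϑ) t x
  /-- `∂ₜψ₂ = ∂ₜu` on `(0,T')` -/
  dt₂ : ∀ t ∈ Ioo 0 T', ∀ x, timeDeriv ψ₂ t x = timeDeriv u t x
  /-- `∂ₜψ₃ = ∂ₜϑ` on `(0,T')` -/
  dt₃ : ∀ t ∈ Ioo 0 T', ∀ x, timeDeriv ψ₃ t x = timeDeriv ϑ t x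

variable {eos : EulerEOS} {T T₁ : ℝ} {ρ : ℝ → UnitAddTorus (Fin 3) → ℝ}
  {u : ℝ → UnitAddTorus (Fin 3) → EuclideanSpace ℝ (Fin 3)} {ϑ : ℝ → UnitAddTorus (Fin 3) → ℝ}
  {Y : Kernel (ℝ × UnitAddTorus (Fin 3)) EulerPhase} {D : ℝ → ℝ}

/-- Test triples exist (`Torus.exists_contDiff_one_extension`). [folklore] -/
theorem nonempty_testTriple (h : IsClassicalEulerSolution eos T₁ ρ u ϑ) (hG : eos.IsGibbs)
    (hT : 0 < T) (hTT₁ : T < T₁) : Nonempty (TestTriple eos T T₁ ρ u ϑ) := by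
  have hT'1 : 0 < (T + T₁) / 2 := by linarith
  have hT'2 : (T + T₁) / 2 < T₁ := by linarith
  obtain ⟨ψ₁, h1, e1, d1⟩ := Torus.exists_contDiff_one_extension
    (h.contDiffOn_stLift_energyTestFunction hG) hT'1 hT'2
  obtain ⟨ψ₂, h2, e2, d2⟩ := (h.smooth_velocity).exists_contDiff_one_extension hT'1 hT'2
  obtain ⟨ψ₃, h3, e3, d3⟩ := (h.smooth_temperature).exists_contDiff_one_extension hT'1 hT'2
  have hTm : T < (T + T₁) / 2 := by linarith
  exact ⟨⟨(T + T₁) / 2, hTm, hT'2, ψ₁, ψ₂, ψ₃, h1, h2, h3, e1, e2, e3, d1, d2, d3⟩⟩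

namespace TestTriple

variable (Ψ : TestTriple eos T T₁ ρ u ϑ)

/-- On `(0,T')`: `∂ₜψ₁ = ∂ₜφ₁` equals the closed form `φ₁t` of the point data. [folklore] -/
theorem timeDeriv_ψ₁ (h : IsClassicalEulerSolution eos T₁ ρ u ϑ) (hG : eos.IsGibbs) {t : ℝ}
    (ht : t ∈ Ioo 0 Ψ.T') (x : UnitAddTorus (Fin 3)) :
    timeDeriv Ψ.ψ₁ t x = (pdAt T₁ ρ u ϑ (t, x)).φ₁t eos := by
  have ht₁ : t ∈ Ioo 0 T₁ := ⟨ht.1, ht.2.trans Ψ.hT'⟩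
  rw [Ψ.dt₁ t ht x, ← timeDerivWithin_of_mem_interior (S := Ico 0 T₁) (by rw [interior_Ico]; exact ht₁),
    h.timeDerivWithin_energyTestFunction hG (Ioo_subset_Ico_self ht₁) x]

/-- On `[0,T']`: `∇ψ₁ = ∇φ₁`, coordinates `gφ₁`. [folklore] -/
theorem gradient_ψ₁ (h : IsClassicalEulerSolution eos T₁ ρ u ϑ) (hG : eos.IsGibbs) {t : ℝ}
    (ht : t ∈ Icc 0 Ψ.T') (ht₁ : t ∈ Ico 0 T₁) (x : UnitAddTorus (Fin 3)) (j : Fin 3) :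
    Torus.gradient (Ψ.ψ₁ t) x j = (pdAt T₁ ρ u ϑ (t, x)).gφ₁ eos j := by
  have : Ψ.ψ₁ t = energyTestFunction eos ρ u ϑ t := funext (Ψ.eq₁ t ht)
  rw [this, h.gradient_energyTestFunction hG ht₁ x j]

/-- On `(0,T')`: `∂ₜψ₂ = ∂ₜu = Ut`. [folklore] -/
theorem timeDeriv_ψ₂ {t : ℝ} (ht : t ∈ Ioo 0 Ψ.T') (x : UnitAddTorus (Fin 3)) :
    timeDeriv Ψ.ψ₂ t x = (pdAt T₁ ρ u ϑ (t, x)).Ut := by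
  have ht₁ : t ∈ Ioo 0 T₁ := ⟨ht.1, ht.2.trans Ψ.hT'⟩
  rw [Ψ.dt₂ t ht x, ← timeDerivWithin_of_mem_interior (S := Ico 0 T₁) (by rw [interior_Ico]; exact ht₁)]
  rfl

/-- On `[0,T']`: `∂ⱼ(ψ₂)ᵢ = ∂ⱼuᵢ = gU i j` and `div ψ₂ = divU`. [folklore] -/
theorem partialDeriv_ψ₂ {t : ℝ} (ht : t ∈ Icc 0 Ψ.T') (x : UnitAddTorus (Fin 3)) (i j : Fin 3) :
    partialDeriv j (fun y => Ψ.ψ₂ t y i) x = (pdAt T₁ ρ u ϑ (t, x)).gU i j ∧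
    Torus.divergence (Ψ.ψ₂ t) x = (pdAt T₁ ρ u ϑ (t, x)).divU := by
  have : Ψ.ψ₂ t = u t := funext (Ψ.eq₂ t ht)
  rw [this]
  exact ⟨rfl, rfl⟩

/-- On `(0,T')`: `∂ₜψ₃ = ∂ₜϑ = Θt`; on `[0,T']`: `∇ψ₃ = ∇ϑ`. [folklore] -/
theorem timeDeriv_ψ₃ {t : ℝ} (ht : t ∈ Ioo 0 Ψ.T') (x : UnitAddTorus (Fin 3)) :
    timeDeriv Ψ.ψ₃ t x = (pdAt T₁ ρ u ϑ (t, x)).Θt := by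
  have ht₁ : t ∈ Ioo 0 T₁ := ⟨ht.1, ht.2.trans Ψ.hT'⟩
  rw [Ψ.dt₃ t ht x, ← timeDerivWithin_of_mem_interior (S := Ico 0 T₁) (by rw [interior_Ico]; exact ht₁)]
  rfl

/-- On `[0,T']`: `∇ψ₃ = ∇ϑ`, coordinates `gΘ`. [folklore] -/
theorem gradient_ψ₃ {t : ℝ} (ht : t ∈ Icc 0 Ψ.T') (x : UnitAddTorus (Fin 3)) (j : Fin 3) :
    Torus.gradient (Ψ.ψ₃ t) x j = (pdAt T₁ ρ u ϑ (t, x)).gΘ j := by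
  have : Ψ.ψ₃ t = ϑ t := funext (Ψ.eq₃ t ht)
  rw [this]
  rfl

end TestTriple


/-! ## Coefficient bounds -/

/-- Uniform bounds on the coefficients of the strong solution on `[0,T] × 𝕋³` used by the
relative-energy argument: `|½|U|² - μ(r,Θ)|, |p(r,Θ)|, |Θ|, |∂ₜp(r,Θ)|, |∂ₜφ₁|, |∂ⱼφ₁|, |∂ⱼp(r,Θ)| ≤ N`.
[folklore] -/
def CoeffBound (eos : EulerEOS) (T₁ : ℝ) (ρ : ℝ → UnitAddTorus (Fin 3) → ℝ)
    (u : ℝ → UnitAddTorus (Fin 3) → EuclideanSpace ℝ (Fin 3)) (ϑ : ℝ → UnitAddTorus (Fin 3) → ℝ)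
    (T N : ℝ) : Prop :=
  ∀ t ∈ Icc (0 : ℝ) T, ∀ x,
    |‖(pdAt T₁ ρ u ϑ (t, x)).U‖ ^ 2 / 2 -
        eos.chemPotential (pdAt T₁ ρ u ϑ (t, x)).r (pdAt T₁ ρ u ϑ (t, x)).Θ| ≤ N ∧
    |eos.p (pdAt T₁ ρ u ϑ (t, x)).r (pdAt T₁ ρ u ϑ (t, x)).Θ| ≤ N ∧ |(pdAt T₁ ρ u ϑ (t, x)).Θ| ≤ N ∧
    |(pdAt T₁ ρ u ϑ (t, x)).pt eos| ≤ N ∧ |(pdAt T₁ ρ u ϑ (t, x)).φ₁t eos| ≤ N ∧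
    (∀ j, |(pdAt T₁ ρ u ϑ (t, x)).gφ₁ eos j| ≤ N) ∧ ∀ j, |(pdAt T₁ ρ u ϑ (t, x)).gp eos j| ≤ N


/-! ## The lower cut-off -/

/-- The non-positive entropy cut-off `Z₋(s) = max(min(s - a, 0), -1)`, vanishing exactly on
`{s ≥ a}`. [cite: BrezinaFeireisl2018, proof of Lemma 2.5] -/
def lowerCutoff (a s : ℝ) : ℝ := max (min (s - a) 0) (-1)

/-- `Z₋ ≤ 0`. [folklore] -/
theorem lowerCutoff_nonpos (a s : ℝ) : lowerCutoff a s ≤ 0 :=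
  max_le (min_le_right _ _) (by norm_num)

/-- `-1 ≤ Z₋`. [folklore] -/
theorem neg_one_le_lowerCutoff (a s : ℝ) : -1 ≤ lowerCutoff a s := le_max_right _ _

/-- `|Z₋| ≤ 1`. [folklore] -/
theorem abs_lowerCutoff_le (a s : ℝ) : |lowerCutoff a s| ≤ 1 := by
  rw [abs_le]; exact ⟨neg_one_le_lowerCutoff a s, (lowerCutoff_nonpos a s).trans zero_le_one⟩

/-- `Z₋(s) = 0 ↔ a ≤ s`. [folklore] -/
theorem lowerCutoff_eq_zero_iff {a s : ℝ} : lowerCutoff a s = 0 ↔ a ≤ s := by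
  unfold lowerCutoff
  constructor
  · intro h
    by_contra hlt
    have hlt := not_le.1 hlt
    have h1 : min (s - a) 0 < 0 := by
      rw [min_lt_iff]; left; linarith
    have : max (min (s - a) 0) (-1) < 0 := max_lt h1 (by norm_num)
    linarith
  · intro h
    rw [min_eq_right (by linarith : (0 : ℝ) ≤ s - a)]
    norm_num

/-- `Z₋` is an admissible entropy cut-off. [folklore] -/
theorem isEntropyCutoff_lowerCutoff (a : ℝ) : IsEntropyCutoff (lowerCutoff a) := by
  refine ⟨?_, ?_, ⟨1, abs_lowerCutoff_le a⟩⟩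
  · unfold lowerCutoff
    exact ((continuous_id.sub continuous_const).min continuous_const).max continuous_const
  · intro s t hst
    unfold lowerCutoff
    exact max_le_max (min_le_min (sub_le_sub_right hst a) le_rfl) le_rfl

/-! ## Constant test function -/

/-- The constant `1` is a test function. [folklore] -/
theorem isTestFunction_one : IsTestFunction (fun (_ : ℝ) (_ : UnitAddTorus (Fin 3)) => (1 : ℝ)) :=
  contDiff_const

/-- `∂ₜ 1 = 0`. [folklore] -/
theorem timeDeriv_one (t : ℝ) (x : UnitAddTorus (Fin 3)) :
    timeDeriv (fun (_ : ℝ) (_ : UnitAddTorus (Fin 3)) => (1 : ℝ)) t x = 0 := by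
  unfold timeDeriv; exact deriv_const t 1

/-- `∇ 1 = 0`. [folklore] -/
theorem gradient_one (x : UnitAddTorus (Fin 3)) :
    Torus.gradient (fun _ : UnitAddTorus (Fin 3) => (1 : ℝ)) x = 0 := by
  unfold Torus.gradient liftAt
  exact gradient_fun_const 0 1


/-! ## The pressure flux and the averaged relative energies -/

/-- The pressure-flux divergence `p(r,Θ) divU + U·∇p(r,Θ)` of the point data. [folklore] -/
def divPU (eos : EulerEOS) (d : StrongPointData) : ℝ := eos.p d.r d.Θ * d.divU + ∑ j, d.U j * d.gp eos j

/-! ## The averaged relative energies -/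

/-- `G(z) = ⟨Y_z; ℰ(· | d_z)⟩`, the averaged relative energy without cut-off. [cite: BrezinaFeireisl2018, (3.3)] -/
def avgRelEnergy (eos : EulerEOS) (T₁ : ℝ) (ρ : ℝ → UnitAddTorus (Fin 3) → ℝ)
    (u : ℝ → UnitAddTorus (Fin 3) → EuclideanSpace ℝ (Fin 3)) (ϑ : ℝ → UnitAddTorus (Fin 3) → ℝ)
    (Y : Kernel (ℝ × UnitAddTorus (Fin 3)) EulerPhase) (z : ℝ × UnitAddTorus (Fin 3)) : ℝ :=
  ∫ w, relEnergyFull eos (pdAt T₁ ρ u ϑ z) (dens w) (ien w) (mom w) ∂(Y z)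

/-- `G_Z(z) = ⟨Y_z; ℰ_Z(· | d_z)⟩`, the averaged relative energy with the cut-off `clamp a b`.
[cite: BrezinaFeireisl2018, (3.3)] -/
def avgRelEnergyZ (eos : EulerEOS) (T₁ : ℝ) (ρ : ℝ → UnitAddTorus (Fin 3) → ℝ)
    (u : ℝ → UnitAddTorus (Fin 3) → EuclideanSpace ℝ (Fin 3)) (ϑ : ℝ → UnitAddTorus (Fin 3) → ℝ)
    (Y : Kernel (ℝ × UnitAddTorus (Fin 3)) EulerPhase) (a b : ℝ) (z : ℝ × UnitAddTorus (Fin 3)) : ℝ :=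
  ∫ w, (pdAt T₁ ρ u ϑ z).relEnergyZ eos (clamp a b) w ∂(Y z)


end CompressibleEuler

end Literature.Analysis.FluidPDE
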